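import Summits.Schanuel.Schanuel.Theorems.ZilberEacIrrationalPhaseBranch
import Summits.Schanuel.Schanuel.Theorems.ZilberEacPoleFibreAsymptotics
import Summits.Schanuel.Schanuel.Theorems.ZilberEacBranchPoleFibreGrowth
import HarnessLib

/-!
# Arbitrary base branches, LXXVIII: the SLOW REGIME along the pole-fibre points — an abstract
# second coordinate `γ(s)s^{-M'}` (`M' < k`) with a non-resonant top phase gives density, for
# every fibre value (growth / Kronecker), ready for SL₂(ℤ)-transport

HONEST FRAMING.  Cell `pub-schanuel` (Zilber's Exponential-Algebraic Closedness, case ladder;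
host summit Schanuel), seat 2, gen 32.  Two engines.
* **`unprojectedDense_of_polynomial_phases`** (Kronecker, bare form): exponential points `q_j` of an
  irreducible surface `S` (`dim S ≤ 2`) with `‖x₀(q_j)‖ → ∞` and
  `y₁(q_j) = urot(g_I(m₀ + j))·w_j`, `w_j → w₀ ≠ 0`, `g_I ∈ ℝ[X]` with an IRRATIONAL coefficient of
  positive index ⟹ `I(S ∩ Γ_exp) = I(S)` (file LXXII's branch (c) without the exact witness
  identity: a relation `H(x₀, y₁) = 0` on all points would force the phases to accumulate at a
  finite set, `phases_near_finset_of_relation`; they do not, `urot_eval_not_near_finset`).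
* **`unprojectedDense_of_slowCoordinate`**: along the points of file XXXI for a place `x₀ = s^{-k}`
  with fibre value `ψ(s)s^L` (ANY `L`), restricted to the labels `n = m^k` (so that
  `s^{-1} = z·m·u^{-1}` with `u^{-1} = 1 + O(log n/n)`, file LXXIV(a)), ANY coordinate of the points
  of the form `γ(s)s^{-M'}` with `1 ≤ M' < k`, `γ` analytic, is `Q(m) + o(1) + O(1)` with
  `Q = (Taylor_{M'}γ)∘(zX) ∈ ℂ[X]`, `Q_{M'} = γ(0)z^{M'}`: if `Re Q` is non-constant THEOREM G,
  otherwise the phases are `urot(g_I(m))` and the first engine applies — so density follows from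
  `Re(γ(0)z^{M'}) ≠ 0 ∨ Im(γ(0)z^{M'})/2π ∉ ℚ`.  The statement is ABSTRACT in the surface and in
  which coordinate carries `γ(s)s^{-M'}` (hypotheses `hx0 : ‖q_j(x₀)‖ → ∞`,
  `hx1 : q_j(x₁) = γ(s_j)s_j^{-M'}`), so that it applies verbatim to the SL₂(ℤ)-transport `Φ_U(S)`
  of a surface over a curve with a RATIONAL asymptotic direction whose sheared coordinate
  `qx₁ − px₀` is slow (next file), as well as directly:
* **`unprojectedDense_branch_slow_of_not_resonant`** — cylinder germ
  `(s^{-k}, Φ(s)s^{-M}, ψ(s)s^L, e^{x₁})`, `1 ≤ M < k`, ANY `L`, top phase non-resonant ⟹ dense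
  (slow-regime POLE fibres in a bad direction were open: file XXXV needs `M > k`).
Decided instances of an OPEN question (Mantova–Masser, PLMS 2024 §1 p. 5); EC(3,2) OPEN; NOT
Schanuel's conjecture (neither used nor implied); EAC ⇏ SC.
-/

noncomputable section

open Filter Topology Metric Complex Polynomial
open Literature.NumberTheory.Transcendental Literature.ModelTheory.Zilber
open Literature.ModelTheory.ExponentialFields

set_option linter.dupNamespace false

namespace Summit.Schanuel.Schanuel.Theorems

/-! ## Part A. Kronecker, bare form -/

/-- **Density from polynomial phases with an irrational coefficient.**  `S` irreducible closed of
dimension `≤ 2`; exponential points `q_j ∈ S` with `‖x₀(q_j)‖ → ∞` and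
`y₁(q_j) = urot(g_I(m₀ + j))·w_j`, `w_j → w₀ ≠ 0`; `g_I` has an irrational coefficient of positive
index.  Then `I(S ∩ Γ_exp) = I(S)`. [cite: MantovaMasser2023, §1 Further remarks, p. 5 (the
question, open in general)] (new) -/
theorem unprojectedDense_of_polynomial_phases {S : Set (Fin 2 ⊕ Fin 2 → ℂ)}
    (hS : IsIrreducibleClosed ℂ S) (hdim : zariskiDim ℂ S ≤ (2 : ℕ))
    (gI : ℝ[X]) (hirr : ∃ j, 1 ≤ j ∧ Irrational (gI.coeff j)) (m₀ : ℕ)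
    {q : ℕ → Fin 2 ⊕ Fin 2 → ℂ} (hqS : ∀ j, q j ∈ S) (hqΓ : ∀ j, q j ∈ expGraph ℂ 2)
    (hnorm : Tendsto (fun j => ‖q j (Sum.inl 0)‖) atTop atTop)
    {w : ℕ → ℂ} {w₀ : ℂ} (hw₀ : w₀ ≠ 0) (hw : Tendsto w atTop (𝓝 w₀))
    (hid : ∀ j, q j (Sum.inr 1) = urot (gI.eval ((m₀ + j : ℕ) : ℝ)) * w j) :
    UnprojectedDense S := by
  classical
  have hfar := urot_eval_not_near_finset gI hirr
  by_contra hnot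
  have hex : ∃ f, f ∈ MvPolynomial.vanishingIdeal ℂ (S ∩ expGraph ℂ 2) ∧
      f ∉ MvPolynomial.vanishingIdeal ℂ S := by
    by_contra h
    push Not at h
    exact hnot (le_antisymm h (MvPolynomial.vanishingIdeal_anti_mono Set.inter_subset_left))
  obtain ⟨f, hfΓ, hfS⟩ := hex
  obtain ⟨H, hH0, hH⟩ := exists_polyPoly_relation_of_forall_aeval_eq_zero hS hdim hqS hfS
    (fun m => (MvPolynomial.mem_vanishingIdeal_iff.1 hfΓ) _ ⟨hqS m, hqΓ m⟩) (Sum.inl 0) (Sum.inr 1)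
  set e : ℕ → ℂ := fun m => urot (gI.eval ((m₀ + m : ℕ) : ℝ)) with he
  have he1 : ∀ m, ‖e m‖ = 1 := fun m => norm_urot _
  have hrel : ∀ m, (H.map (Polynomial.evalRingHom (q m (Sum.inl 0)))).eval (e m * w m) = 0 := by
    intro m
    have h1 := hH m
    rwa [hid m] at h1
  obtain ⟨F, hF⟩ := phases_near_finset_of_relation hH0 hnorm he1 hw₀ hw hrel
  obtain ⟨ε, hε, hfar'⟩ := hfar F
  obtain ⟨m₁, hm₁⟩ := Filter.eventually_atTop.1 (hF ε hε)
  obtain ⟨k', hk', hkfar⟩ := hfar' (m₀ + m₁)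
  obtain ⟨ζ, hζF, hζ⟩ := hm₁ (k' - m₀) (by omega)
  have hkk : m₀ + (k' - m₀) = k' := by omega
  rw [he] at hζ
  simp only [hkk] at hζ
  exact absurd hζ (not_lt.2 (hkfar ζ hζF))

/-! ## Part B. The slow coordinate along the pole-fibre points -/

/-- Top coefficient of `P∘(zX)`: `[X^d](P∘(zX)) = [X^d]P · z^d` when `deg P = d`. [folklore] -/
theorem coeff_comp_C_mul_X_natDegree (P : ℂ[X]) {z : ℂ} (hz : z ≠ 0) :
    (P.comp (Polynomial.C z * X)).coeff P.natDegree = P.coeff P.natDegree * z ^ P.natDegree := by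
  have hq : (Polynomial.C z * X : ℂ[X]).natDegree = 1 := Polynomial.natDegree_C_mul_X z hz
  have h := Polynomial.coeff_comp_degree_mul_degree (p := P) (q := Polynomial.C z * X)
    (by rw [hq]; exact one_ne_zero)
  rw [hq, mul_one, Polynomial.leadingCoeff_C_mul_X] at h
  rw [h, Polynomial.leadingCoeff]

/-- **The slow coordinate.**  Data: a `k`-th root `z` of `2πi` and the pole-fibre points of file
XXXI (`u_j`, `s_j = z^{-1}e^{−(log n_j)/k}u_j`, `n_j = N₀ + j`, `‖w_j‖ ≤ W`,
`u_j = exp(−log(1 + ε_j)/k)`); exponential points `q_j ∈ S` (`S` irreducible closed, `dim ≤ 2`) with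
`‖x₀(q_j)‖ → ∞` and `x₁(q_j) = γ(s_j)s_j^{-M'}`, `γ` analytic at `0`, `1 ≤ M' < k`; top phase
`γ(0)z^{M'}` with nonzero real part or irrational imaginary part `/2π`.  Then `I(S ∩ Γ_exp) = I(S)`.
[cite: MantovaMasser2023, §1 Further remarks, p. 5 (the question, open in general)] (new) -/
theorem unprojectedDense_of_slowCoordinate {S : Set (Fin 2 ⊕ Fin 2 → ℂ)}
    (hS : IsIrreducibleClosed ℂ S) (hdim : zariskiDim ℂ S ≤ (2 : ℕ))
    {k : ℕ} (hk : 1 ≤ k) {z : ℂ} (hz : z ^ k = 2 * Real.pi * I) (L : ℤ) {N₀ : ℕ} (hN₀ : 1 ≤ N₀)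
    {u s w : ℕ → ℂ} {W : ℝ} (hu : Tendsto u atTop (𝓝 1)) (hwW : ∀ j, ‖w j‖ ≤ W)
    (hudef : ∀ j, u j = Complex.exp (-(Complex.log (1 + ((-(L : ℂ) / k) *
      (Real.log ((N₀ + j : ℕ) : ℝ) : ℂ) + w j) / (((N₀ + j : ℕ) : ℂ) * (2 * Real.pi * I)))) / k))
    (hsu : ∀ j, s j = z⁻¹ * Complex.exp (-(Real.log ((N₀ + j : ℕ) : ℝ) : ℂ) / k) * u j)
    (hs0 : ∀ j, s j ≠ 0) (hs : Tendsto s atTop (𝓝 0))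
    {q : ℕ → Fin 2 ⊕ Fin 2 → ℂ} (hqS : ∀ j, q j ∈ S) (hqΓ : ∀ j, q j ∈ expGraph ℂ 2)
    (hx0 : Tendsto (fun j => ‖q j (Sum.inl 0)‖) atTop atTop)
    {M' : ℕ} (hM' : 1 ≤ M') (hM'k : M' < k) {γ : ℂ → ℂ} (hγ : AnalyticAt ℂ γ 0)
    (hx1 : ∀ j, q j (Sum.inl 1) = γ (s j) * (s j ^ M')⁻¹)
    (hdir : (γ 0 * z ^ M').re ≠ 0 ∨ Irrational ((γ 0 * z ^ M').im / (2 * Real.pi))) :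
    UnprojectedDense S := by
  classical
  have hk0 : k ≠ 0 := by omega
  have hkR : (0 : ℝ) < k := by exact_mod_cast Nat.pos_of_ne_zero hk0
  have h2πI : (2 * Real.pi * I : ℂ) ≠ 0 := by simp [Real.pi_ne_zero, Complex.I_ne_zero]
  have hz0 : z ≠ 0 := by
    rintro rfl
    rw [zero_pow hk0] at hz
    exact h2πI hz.symm
  have hγ0 : γ 0 ≠ 0 := by
    rintro h
    rw [h, zero_mul, Complex.zero_re, Complex.zero_im, zero_div] at hdir
    rcases hdir with h | h
    · exact h rfl
    · exact h ⟨0, by simp⟩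
  -- the labels `n = (m₁ + m)^k`: indices `J m = (m₁ + m)^k − N₀`
  set m₁ : ℕ := N₀ + 1 with hm₁
  have hpow : ∀ m, N₀ ≤ (m₁ + m) ^ k := fun m => by
    calc N₀ ≤ m₁ + m := by omega
      _ ≤ (m₁ + m) ^ k := Nat.le_self_pow hk0 _
  set J : ℕ → ℕ := fun m => (m₁ + m) ^ k - N₀ with hJ
  have hnJ : ∀ m, N₀ + J m = (m₁ + m) ^ k := fun m => by simp only [hJ]; have := hpow m; omega
  have hJt : Tendsto J atTop atTop := by
    refine tendsto_atTop_mono (fun m => ?_) tendsto_id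
    simp only [hJ, id]
    have h1 : m₁ + m ≤ (m₁ + m) ^ k := Nat.le_self_pow hk0 _
    omega
  have hlab1 : ∀ m, (1 : ℝ) ≤ ((m₁ + m : ℕ) : ℝ) := fun m => by
    exact_mod_cast (show 1 ≤ m₁ + m by omega)
  have hlabpos : ∀ m, (0 : ℝ) < ((m₁ + m : ℕ) : ℝ) := fun m => by linarith [hlab1 m]
  -- `e^{ℓ/k} = m₁ + m` along the subsequence
  have hE : ∀ m, Real.exp (Real.log ((N₀ + J m : ℕ) : ℝ) / k) = ((m₁ + m : ℕ) : ℝ) := by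
    intro m
    rw [hnJ m, Nat.cast_pow, Real.log_pow, mul_div_cancel_left₀ _ hkR.ne',
      Real.exp_log (hlabpos m)]
  have hcast : ∀ m, (-(Real.log ((N₀ + J m : ℕ) : ℝ) : ℂ) / k) =
      -(((Real.log ((N₀ + J m : ℕ) : ℝ) / k : ℝ) : ℂ)) := by
    intro m
    push_cast
    ring
  have hsinv : ∀ m, (s (J m))⁻¹ = z * (((m₁ + m : ℕ) : ℝ) : ℂ) * (u (J m))⁻¹ := by
    intro m
    rw [hsu (J m), mul_inv, mul_inv, inv_inv, hcast m, Complex.exp_neg, inv_inv,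
      ← Complex.ofReal_exp, hE m]
  -- Taylor split of `γ` to order `M'`, and `Q = Pol∘(zX)`
  obtain ⟨Pol, R, hPdeg, hPk, hRan, hsplit⟩ := exists_taylor_split_coeff hγ M'
  have hPolM : Pol.natDegree = M' :=
    le_antisymm hPdeg (Polynomial.le_natDegree_of_ne_zero (by rw [hPk]; exact hγ0))
  set Q : ℂ[X] := Pol.comp (Polynomial.C z * X) with hQ
  have hQeval : ∀ y : ℂ, Pol.eval (z * y) = Q.eval y := by
    intro y
    simp only [hQ, Polynomial.eval_comp, Polynomial.eval_mul, Polynomial.eval_C, Polynomial.eval_X]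
  have hQdeg : Q.natDegree ≤ k - 1 := by
    refine (Polynomial.natDegree_comp_le).trans ?_
    rw [Polynomial.natDegree_C_mul_X z hz0, mul_one]
    omega
  have hQtop : Q.coeff M' = γ 0 * z ^ M' := by
    rw [hQ, ← hPolM, coeff_comp_C_mul_X_natDegree Pol hz0, hPolM, hPk]
  -- `x₁ = Q((m₁+m)u⁻¹) + R(s)`
  have hx1' : ∀ m, q (J m) (Sum.inl 1) =
      Q.eval ((((m₁ + m : ℕ) : ℝ) : ℂ) * (u (J m))⁻¹) + R (s (J m)) := by
    intro m
    rw [hx1 (J m), ← inv_pow, hsplit _ (hs0 _), hsinv m, mul_assoc, hQeval]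
  obtain ⟨gR, gI, hgR, hexpPK, hgIc⟩ := exists_re_im_polynomials_coeff Q
  set D : ℕ → ℂ := fun m =>
    Q.eval ((((m₁ + m : ℕ) : ℝ) : ℂ) * (u (J m))⁻¹) - Q.eval (((m₁ + m : ℕ) : ℝ) : ℂ) with hD
  have huJ : Tendsto (fun m => u (J m)) atTop (𝓝 1) := hu.comp hJt
  have hsJ : Tendsto (fun m => s (J m)) atTop (𝓝 0) := hs.comp hJt
  have hDt : Tendsto D atTop (𝓝 0) := by
    have hv2 : ∀ᶠ m in atTop, ‖(u (J m))⁻¹‖ ≤ 2 := by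
      have h1 : Tendsto (fun m => (u (J m))⁻¹) atTop (𝓝 1) := by
        have := huJ.inv₀ one_ne_zero
        rwa [inv_one] at this
      filter_upwards [Metric.tendsto_nhds.1 h1 1 one_pos] with m hm
      rw [dist_eq_norm] at hm
      have := norm_le_norm_add_norm_sub' (u (J m))⁻¹ 1
      rw [norm_one] at this
      linarith
    have hrate : Tendsto (fun m => ((m₁ + m : ℕ) : ℝ) ^ (k - 1) * ‖(u (J m))⁻¹ - 1‖)
        atTop (𝓝 0) := by
      have h := (tendsto_exp_pow_mul_norm_inv_sub_one hk L hN₀ hwW hudef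
        (d := k - 1) (by omega)).comp hJt
      refine h.congr fun m => ?_
      simp only [Function.comp_apply, hE m]
    exact tendsto_eval_mul_sub_eval Q hQdeg hlab1 hv2 hrate
  have hx1'' : ∀ m, q (J m) (Sum.inl 1) = Q.eval (((m₁ + m : ℕ) : ℝ) : ℂ) + (D m + R (s (J m))) := by
    intro m
    rw [hx1' m, hD]
    ring
  -- `y₁ = e^{x₁}`
  have hexp₁ : ∀ m, q (J m) (Sum.inr 1) = Complex.exp (q (J m) (Sum.inl 1)) := fun m => by
    have h := (mem_expGraph_iff.1 (hqΓ (J m))) 1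
    rw [h, Literature.ModelTheory.ExponentialFields.ExponentialRing.complex_exp_eq]
  have hRt : Tendsto (fun m => R (s (J m))) atTop (𝓝 (R 0)) := hRan.continuousAt.tendsto.comp hsJ
  by_cases hgRdeg : 1 ≤ gR.natDegree
  · /- GROWTH -/
    obtain ⟨c, hc, hev⟩ := eventually_mul_le_abs_eval gR hgRdeg
    have hlabt : Tendsto (fun m => ((m₁ + m : ℕ) : ℝ)) atTop atTop :=
      tendsto_natCast_atTop_atTop.comp ((tendsto_add_atTop_nat m₁).congr fun m => by ring)
    set t : ℕ → ℝ := fun m => Real.log ((m₁ + m : ℕ) : ℝ) with ht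
    have htt : Tendsto t atTop atTop := Real.tendsto_log_atTop.comp hlabt
    have hEt : ∀ m, Real.exp (1 * t m) = ((m₁ + m : ℕ) : ℝ) := fun m => by
      rw [one_mul, ht, Real.exp_log (hlabpos m)]
    have hgrow : ∀ᶠ m in atTop, c * ((m₁ + m : ℕ) : ℝ) ≤ |gR.eval ((m₁ + m : ℕ) : ℝ)| :=
      hlabt.eventually hev
    have hDre : ∀ᶠ m in atTop, |(D m).re| ≤ 1 := by
      filter_upwards [Metric.tendsto_nhds.1 hDt 1 one_pos] with m hm
      rw [dist_eq_norm, sub_zero] at hm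
      exact (Complex.abs_re_le_norm _).trans hm.le
    have hRre : ∀ᶠ m in atTop, |(R (s (J m))).re| ≤ ‖R 0‖ + 1 := by
      filter_upwards [Metric.tendsto_nhds.1 hRt 1 one_pos] with m hm
      rw [dist_eq_norm] at hm
      refine (Complex.abs_re_le_norm _).trans ?_
      have := norm_le_norm_add_norm_sub' (R (s (J m))) (R 0)
      linarith
    have hsmall : ∀ᶠ m in atTop, 1 + (‖R 0‖ + 1) ≤ c / 2 * ((m₁ + m : ℕ) : ℝ) :=
      (hlabt.const_mul_atTop (by positivity : 0 < c / 2)).eventually (eventually_ge_atTop _)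
    have hreal : ∀ᶠ m in atTop, c / 2 * Real.exp (1 * t m) ≤ |(q (J m) (Sum.inl 1)).re| := by
      filter_upwards [hgrow, hDre, hRre, hsmall] with m hgm hDm hRm hsm
      rw [hEt m, hx1'' m, Complex.add_re, Complex.add_re,
        show ((((m₁ + m : ℕ) : ℝ) : ℂ)) = ((((m₁ + m : ℕ) : ℝ)) : ℂ) from rfl, hgR]
      have h2 := abs_sub_abs_le_abs_sub (gR.eval ((m₁ + m : ℕ) : ℝ))
        (-((D m).re + (R (s (J m))).re))
      have h3 : |-((D m).re + (R (s (J m))).re)| ≤ 1 + (‖R 0‖ + 1) := by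
        rw [abs_neg]
        exact (abs_add_le _ _).trans (add_le_add hDm hRm)
      rw [sub_neg_eq_add] at h2
      linarith
    -- `‖x₁‖ ≤ e^{(M'+1) t}` eventually
    have hnorm : ∀ᶠ m in atTop, ‖q (J m) (Sum.inl 1)‖ ≤ Real.exp (((M' : ℝ) + 1) * t m) := by
      have hγb : ∀ᶠ m in atTop, ‖γ (s (J m))‖ ≤ ‖γ 0‖ + 1 := by
        have h1 : Tendsto (fun m => γ (s (J m))) atTop (𝓝 (γ 0)) :=
          hγ.continuousAt.tendsto.comp hsJ
        filter_upwards [Metric.tendsto_nhds.1 h1 1 one_pos] with m hm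
        rw [dist_eq_norm] at hm
        have := norm_le_norm_add_norm_sub' (γ (s (J m))) (γ 0)
        linarith
      have hub : ∀ᶠ m in atTop, ‖(u (J m))⁻¹‖ ≤ 2 := by
        have h1 : Tendsto (fun m => (u (J m))⁻¹) atTop (𝓝 1) := by
          have := huJ.inv₀ one_ne_zero
          rwa [inv_one] at this
        filter_upwards [Metric.tendsto_nhds.1 h1 1 one_pos] with m hm
        rw [dist_eq_norm] at hm
        have := norm_le_norm_add_norm_sub' (u (J m))⁻¹ 1
        rw [norm_one] at this
        linarith
      have hbig : ∀ᶠ m in atTop, (‖γ 0‖ + 1) * (‖z‖ * 2) ^ M' ≤ ((m₁ + m : ℕ) : ℝ) :=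
        hlabt.eventually (eventually_ge_atTop _)
      filter_upwards [hγb, hub, hbig] with m hγm hum hbm
      have hlab0 : (0 : ℝ) ≤ ((m₁ + m : ℕ) : ℝ) := (hlabpos m).le
      have hx : ‖(s (J m) ^ M')⁻¹‖ ≤ (‖z‖ * 2) ^ M' * ((m₁ + m : ℕ) : ℝ) ^ M' := by
        rw [← inv_pow, hsinv m, norm_pow, norm_mul, norm_mul, Complex.norm_real, Real.norm_eq_abs,
          abs_of_nonneg hlab0, ← mul_pow]
        refine pow_le_pow_left₀ (by positivity) ?_ M'
        calc ‖z‖ * ((m₁ + m : ℕ) : ℝ) * ‖(u (J m))⁻¹‖ ≤ ‖z‖ * ((m₁ + m : ℕ) : ℝ) * 2 :=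
              mul_le_mul_of_nonneg_left hum (by positivity)
          _ = ‖z‖ * 2 * ((m₁ + m : ℕ) : ℝ) := by ring
      rw [hx1 (J m), norm_mul]
      have e1 : Real.exp (((M' : ℝ) + 1) * t m) = ((m₁ + m : ℕ) : ℝ) ^ M' * ((m₁ + m : ℕ) : ℝ) := by
        rw [add_mul, one_mul, Real.exp_add, ht, ← Real.log_pow, Real.exp_log (pow_pos (hlabpos m) _),
          Real.exp_log (hlabpos m)]
      rw [e1]
      calc ‖γ (s (J m))‖ * ‖(s (J m) ^ M')⁻¹‖
          ≤ (‖γ 0‖ + 1) * ((‖z‖ * 2) ^ M' * ((m₁ + m : ℕ) : ℝ) ^ M') :=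
            mul_le_mul hγm hx (norm_nonneg _) (by positivity)
        _ = ((m₁ + m : ℕ) : ℝ) ^ M' * ((‖γ 0‖ + 1) * (‖z‖ * 2) ^ M') := by ring
        _ ≤ ((m₁ + m : ℕ) : ℝ) ^ M' * ((m₁ + m : ℕ) : ℝ) :=
            mul_le_mul_of_nonneg_left hbm (by positivity)
    have hgr := tendsto_growth_ratio_of_exp_bounds (α := 1) (β := (M' : ℝ) + 1) (c := c / 2)
      one_pos (by positivity) (by positivity) htt hreal hnorm
    exact unprojectedDense_of_growth hS hdim 1 (fun m => hqS (J m)) (fun m => hqΓ (J m)) hgr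
  · /- KRONECKER -/
    have hgR0 : gR.natDegree = 0 := by omega
    set r₀ : ℝ := gR.coeff 0 with hr₀
    have hgRev : ∀ x : ℝ, gR.eval x = r₀ := fun x => by
      rw [Polynomial.eq_C_of_natDegree_eq_zero hgR0, Polynomial.eval_C]
    have hirr : ∃ j, 1 ≤ j ∧ Irrational (gI.coeff j) := by
      refine ⟨M', hM', ?_⟩
      rw [hgIc, hQtop]
      rcases hdir with hre | him
      · exfalso
        have h1 := le_natDegree_rePoly hgR (k := M') (by rw [hQtop]; exact hre)
        omega
      · exact him
    set wseq : ℕ → ℂ := fun m => ((Real.exp r₀ : ℝ) : ℂ) * Complex.exp (D m + R (s (J m))) with hw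
    have hwt : Tendsto wseq atTop (𝓝 (((Real.exp r₀ : ℝ) : ℂ) * Complex.exp (0 + R 0))) :=
      tendsto_const_nhds.mul ((Complex.continuous_exp.tendsto _).comp (hDt.add hRt))
    have hw₀ : ((Real.exp r₀ : ℝ) : ℂ) * Complex.exp (0 + R 0) ≠ 0 :=
      mul_ne_zero (by exact_mod_cast (Real.exp_pos r₀).ne') (Complex.exp_ne_zero _)
    refine unprojectedDense_of_polynomial_phases hS hdim gI hirr m₁ (fun m => hqS (J m))
      (fun m => hqΓ (J m)) (hx0.comp hJt) hw₀ hwt fun m => ?_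
    rw [hexp₁ m, hx1'' m, Complex.exp_add, hexpPK, hgRev, hw]
    ring

/-! ## Part C. The direct instance: slow-regime cylinder germs, every fibre value -/

/-- **Slow regime (`1 ≤ M < k`), any fibre value, non-resonant top phase: dense.**  A cylinder germ
`(s^{-k}, Φ(s)s^{-M}, ψ(s)s^L, e^{x₁})` (`L ∈ ℤ` arbitrary, `ψ(0) ≠ 0`, `Φ` analytic) in an
irreducible closed `S` of dimension `≤ 2`, with `Re(Φ(0)z^M) ≠ 0` or `Im(Φ(0)z^M)/2π ∉ ℚ` for SOME
`k`-th root `z` of `2πi`, has `I(S ∩ Γ_exp) = I(S)`.  (Unit fibres: files XIX/LXXII; the POLE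
fibres in a bad direction are new.) [cite: MantovaMasser2023, §1 Further remarks, p. 5 (the
question, open in general)] (new) -/
theorem unprojectedDense_branch_slow_of_not_resonant {S : Set (Fin 2 ⊕ Fin 2 → ℂ)}
    (hS : IsIrreducibleClosed ℂ S) (hdim : zariskiDim ℂ S ≤ (2 : ℕ))
    {k M : ℕ} (hM : 1 ≤ M) (hMk : M < k) (L : ℤ) {ψ : ℂ → ℂ} (hψ : AnalyticAt ℂ ψ 0)
    (hψ0 : ψ 0 ≠ 0) {Φ : ℂ → ℂ} (hΦ : AnalyticAt ℂ Φ 0)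
    (hdir : ∃ z : ℂ, z ^ k = 2 * Real.pi * I ∧
      ((Φ 0 * z ^ M).re ≠ 0 ∨ Irrational ((Φ 0 * z ^ M).im / (2 * Real.pi))))
    (hgerm : ∀ᶠ s in 𝓝[≠] (0 : ℂ),
      (Sum.elim ![(s ^ k)⁻¹, Φ s * (s ^ M)⁻¹] ![ψ s * s ^ L, Complex.exp (Φ s * (s ^ M)⁻¹)] :
        Fin 2 ⊕ Fin 2 → ℂ) ∈ S) :
    UnprojectedDense S := by
  classical
  have hk : 1 ≤ k := by omega
  obtain ⟨z, hz, hzdir⟩ := hdir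
  obtain ⟨N₀, u, s, w, W, hN₀, hu, hu0, hwW, hudef, hsu, hs0, hs, hexp⟩ :=
    exists_poleFibre_expPoints hk L hψ hψ0 hz
  have hsW : Tendsto s atTop (𝓝[≠] (0 : ℂ)) :=
    tendsto_nhdsWithin_iff.2 ⟨hs, Eventually.of_forall hs0⟩
  obtain ⟨J₀, hJ₀⟩ := Filter.eventually_atTop.1 (hsW.eventually hgerm)
  -- shift the data by `J₀` (the points lie in `S` from `J₀` on)
  have hN₀' : 1 ≤ N₀ + J₀ := by omega
  have hidx : ∀ j : ℕ, N₀ + (J₀ + j) = N₀ + J₀ + j := fun j => by ring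
  set p : ℕ → Fin 2 ⊕ Fin 2 → ℂ := fun j =>
    Sum.elim ![(s (J₀ + j) ^ k)⁻¹, Φ (s (J₀ + j)) * (s (J₀ + j) ^ M)⁻¹]
      ![ψ (s (J₀ + j)) * s (J₀ + j) ^ L, Complex.exp (Φ (s (J₀ + j)) * (s (J₀ + j) ^ M)⁻¹)]
    with hp
  have hpS : ∀ j, p j ∈ S := fun j => hJ₀ (J₀ + j) (Nat.le_add_right _ _)
  have hpΓ : ∀ j, p j ∈ expGraph ℂ 2 := by
    intro j
    rw [mem_expGraph_iff]
    intro i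
    rw [Literature.ModelTheory.ExponentialFields.ExponentialRing.complex_exp_eq]
    fin_cases i
    · simp [hp, hexp (J₀ + j)]
    · simp [hp]
  have hst : Tendsto (fun j => s (J₀ + j)) atTop (𝓝 0) :=
    hs.comp ((tendsto_add_atTop_nat J₀).congr fun j => by ring)
  have hx0 : Tendsto (fun j => ‖p j (Sum.inl 0)‖) atTop atTop := by
    have h1 : Tendsto (fun j => ‖s (J₀ + j) ^ k‖⁻¹) atTop atTop := by
      refine Tendsto.inv_tendsto_nhdsGT_zero ?_
      have h2 : Tendsto (fun j => s (J₀ + j) ^ k) atTop (𝓝[≠] 0) :=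
        tendsto_nhdsWithin_iff.2 ⟨by have h := hst.pow k; rwa [zero_pow (by omega)] at h,
          Eventually.of_forall fun j => pow_ne_zero _ (hs0 _)⟩
      exact tendsto_norm_nhdsNE_zero.comp h2
    refine h1.congr fun j => ?_
    simp [hp, norm_inv]
  refine unprojectedDense_of_slowCoordinate hS hdim hk hz L hN₀' (u := fun j => u (J₀ + j))
    (s := fun j => s (J₀ + j)) (w := fun j => w (J₀ + j)) (W := W)
    (hu.comp ((tendsto_add_atTop_nat J₀).congr fun j => by ring)) (fun j => hwW _)
    (fun j => by rw [hudef (J₀ + j), hidx]) (fun j => by rw [hsu (J₀ + j), hidx]) (fun j => hs0 _)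
    hst hpS hpΓ hx0 hM hMk hΦ (fun j => by simp [hp]) hzdir

end Summit.Schanuel.Schanuel.Theorems

end
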